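import Mathlib
import HarnessLib
import Summits.ValiantsHypothesis.ValiantsHypothesis.Theorems.MonotoneRestorationOrbitRestorationQPSimpleGraphCut
import Summits.ValiantsHypothesis.ValiantsHypothesis.Theorems.MonotoneRestorationPolylogWidthMonotoneEasyStatus
import Literature.Computability.AlgebraicComplexity.ValiantConjectureProofs
import Summits.ValiantsHypothesis.ValiantsHypothesis.Theorems.MonotoneRestorationOrbitRestorationQPRungCalibration

/-!
# Route MonotoneRestoration, crux `MonotoneRestorationQP` (stmt-15886), line `linear_width` — GAP 2 IS TIGHT IN ITS OWN
# CURRENCY: the permanent is an arithmetic Cai–Fürer–Immerman family for TWO-SORTED hom-indistinguishability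

Helper file (`--supports stmt-ValiantsHypothesis-15886`), def-free.  The registered GAP 2 `stub_homDeterminedVP : HomDeterminedVP`
("every matrix-symmetric `VP` family is `PolylogHomDetermined`": determined by the homomorphism polynomials of bipartite patterns of
treewidth `< (log₂ n + c)^c` at all complex points) had its load-bearing hypotheses certified only through L1 (`OrbitRestorationFalseWithoutVP`).
With the Dvořák bridge of `…OrbitRestorationQPSimpleGraphCut.lean` (p825758) the certificate is now available IN GAP 2's OWN currency:

* `not_polylogHomDetermined_of_separating` — a family whose values separate, for every level and beyond every order, two
  `≡^{C^{(log₂ m + c)^c}}`-equivalent simple graphs is NOT `PolylogHomDetermined` (contrapositive of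
  `SimpleGraphCut.ckDetermined_of_polylogHomDetermined`);
* `not_polylogHomDetermined_perPoly` — **the permanent family is not `PolylogHomDetermined`**: unconditionally, for every `c`
  there are a level `n` and two points of `ℂ^{n×n}` (the adjacency matrices of the Dawar–Wilsenach CFI matching graphs,
  `perPoly_separates_polylog`) agreeing on ALL `hom_{F,n}` with `tw F < (log₂ n + c)^c` and separated by `per_n`;
* `homDeterminedVP_false_without_VP` — GAP 2 with `IsVPFamily` deleted is FALSE (witness `per`, matrix-symmetric by
  `rename_perm_perPoly`);
* `homDeterminedVNP_false` — GAP 2 with `VNP` in place of `VP` is FALSE (`isVNPFamily_perPoly_holds`), so GAP 2 is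
  irrefutable unless `VP ≠ VNP` fails to protect it, exactly like L1 (`PolylogWidthVP_of_VP_eq_VNP`) — the VP hypothesis is
  the whole content.

Honest label: tightness certificates; no stub closed; GAP 2, the cruxes and VP ≠ VNP NOT moved.
[cite: DawarWilsenach2025, Thm 7.2; Dvorak2010, Thm 6; Valiant1979]
-/

-- `Summit.ValiantsHypothesis.ValiantsHypothesis.…` is the tree's mandated namespace (Sub = Summit).
set_option linter.dupNamespace false

noncomputable section

namespace Summit.ValiantsHypothesis.ValiantsHypothesis.Theorems

namespace SimpleGraphCut

open Summit.ValiantsHypothesis.ValiantsHypothesis.Theses.MonotoneRestoration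
open Literature.Computability.AlgebraicComplexity
open Literature.ModelTheory.FiniteModelTheory
open MonotoneRestorationQPLinearWidth
open MvPolynomial

/-- **Separating ⇒ not `PolylogHomDetermined`.** [folklore] -/
theorem not_polylogHomDetermined_of_separating (f : (n : ℕ) → MvPolynomial (Fin n × Fin n) ℂ)
    (hsep : ∀ c N : ℕ, ∃ m : ℕ, N ≤ m ∧ ∃ X Y : SimpleGraph (Fin m),
      CkEquiv ((Nat.log 2 m + c) ^ c) X Y ∧
        MvPolynomial.eval (Set.indicator {ij : Fin m × Fin m | X.Adj ij.1 ij.2} 1) (f m) ≠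
          MvPolynomial.eval (Set.indicator {ij : Fin m × Fin m | Y.Adj ij.1 ij.2} 1) (f m)) :
    ¬ PolylogHomDetermined f := by
  intro hdet
  obtain ⟨c, hc⟩ := ckDetermined_of_polylogHomDetermined f hdet
  obtain ⟨m, -, X, Y, hXY, hne⟩ := hsep c 0
  exact hne (hc m X Y hXY)

/-- **The permanent is not `PolylogHomDetermined`** — an arithmetic CFI family (in `VNP`) for two-sorted
hom-indistinguishability at complex points. [cite: DawarWilsenach2025, Thm 7.2] -/
theorem not_polylogHomDetermined_perPoly : ¬ PolylogHomDetermined fun n => perPoly (Fin n) ℂ := by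
  refine not_polylogHomDetermined_of_separating _ fun c N => ?_
  obtain ⟨m, hNm, X, Y, hXY, hne⟩ := perPoly_separates_polylog c N
  refine ⟨m, hNm, X, Y, hXY, ?_⟩
  rwa [map_perPoly] at hne

/-- **GAP 2 without `VP` is FALSE**: not every matrix-symmetric family is `PolylogHomDetermined` (witness: the permanent).
[cite: DawarWilsenach2025, Thm 7.2] -/
theorem homDeterminedVP_false_without_VP :
    ¬ ∀ f : (n : ℕ) → MvPolynomial (Fin n × Fin n) ℂ, IsMatrixSymmetric f → PolylogHomDetermined f :=
  fun h => not_polylogHomDetermined_perPoly (h _ OrbitRestorationQPDepthThreeRung.RungCalibration.isMatrixSymmetric_perPoly)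

/-- **GAP 2 with `VNP` in place of `VP` is FALSE** (the permanent is a matrix-symmetric `VNP` family that is not
`PolylogHomDetermined`); so `stub_homDeterminedVP` is exactly as strong as its `VP` hypothesis makes it.
[cite: DawarWilsenach2025, Thm 7.2] -/
theorem homDeterminedVNP_false :
    ¬ ∀ f : (n : ℕ) → MvPolynomial (Fin n × Fin n) ℂ, IsMatrixSymmetric f → IsVNPFamily f → PolylogHomDetermined f :=
  fun h => not_polylogHomDetermined_perPoly
    (h _ OrbitRestorationQPDepthThreeRung.RungCalibration.isMatrixSymmetric_perPoly (isVNPFamily_perPoly_holds ℂ))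

/-- **GAP 2 ⇒ `per ∉ VP`** (hence GAP 2 alone decides the summit, cf. `valiantsHypothesis_of_not_polylogWidthVP`): under
`HomDeterminedVP` the permanent family is not a `VP` family. [folklore] -/
theorem not_isVPFamily_perPoly_of_homDeterminedVP
    (hGAP2 : ∀ f : (n : ℕ) → MvPolynomial (Fin n × Fin n) ℂ, IsMatrixSymmetric f → IsVPFamily f → PolylogHomDetermined f) :
    ¬ IsVPFamily fun n => perPoly (Fin n) ℂ :=
  fun hVP => not_polylogHomDetermined_perPoly (hGAP2 _ OrbitRestorationQPDepthThreeRung.RungCalibration.isMatrixSymmetric_perPoly hVP)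

end SimpleGraphCut

end Summit.ValiantsHypothesis.ValiantsHypothesis.Theorems

end
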